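import Literature.Computability.QuantumComplexity.ShallowCircuitsRing
import Literature.Computability.QuantumComplexity.ShallowCircuitsAncillas
import HarnessLib

/-!
# Cycle instances of 2D HLF, II: the solution set is exactly the ring relation; quantum half

Continuation of `ShallowCircuitsRing.lean` (Bravyi–Gosset–König 2018 §4.1–4.2 restricted to an
embedded cycle `γ` of length `n ≥ 3` with a general linear part `x` on the cycle):

* `GridCycle.q_ringInstance` — the quadratic form of the cycle instance on ANY grid vector `w`:
  `q(w) = 2·#edges(supp w|_γ) + |x ∧ w|_γ| (mod 4)`;
* `RingHLF.even_wtAnd_of_inKernel` — `|x ∧ v|` is even on the ring kernel (BGK Lemma 1 on the ring);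
* `GridCycle.eq_false_of_mem_hlfSolutions`, `mem_hlfSolutions_of_rel`, `mem_hlfSolutions_iff` —
  `hlfSolutions (ringInstance γ x)` is EXACTLY the set of grid vectors vanishing off `γ` whose
  restriction to `γ` solves the ring relation `RingHLF.Rel x` (with part I's
  `rel_of_mem_hlfSolutions`); `GridCycle.rel_nonempty` — the ring relation is solvable;
* `ring_rel_quantum_certain` — QUANTUM HALF of the ring route: BGK's advice-free constant-depth
  circuit `hlfCircuit N` (tree `hlf_quantum_circuit_explicit`: depth `≤ 98`, `N²` ancillas `|0⟩`),
  run on the cycle instance of `GridCycle.square t` (`t ≥ 2`, `N > 2t`), outputs with probability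
  `1` a string whose restriction to the `8t` cycle vertices solves `RingHLF.Rel x` — these are the
  outcome strings of measuring the `8t`-cycle graph state in the `X`/`Y` bases chosen by `x`
  (Barrett et al. 2007 §IV.A).

## References

* S. Bravyi, D. Gosset, R. König, *Quantum advantage with shallow circuits*, Science 362 (2018)
  308–311, arXiv:1704.00690, Theorem 1, §3 Lemma 1, §4.1–4.2 Eq. (31)
  [BravyiGossetKonigScience2018].
* J. Barrett, C. M. Caves, B. Eastin, M. B. Elliott, S. Pironio, Phys. Rev. A 75 (2007) 012103,
  arXiv:quant-ph/0603032, §IV.A [BarrettEtAl2007].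
-/

noncomputable section

namespace Literature.Computability.QuantumComplexity

open Finset SimpleGraph

/-! ### The quadratic form of a cycle instance and the converse transfer -/

namespace RingHLF

variable {n : ℕ}

/-- On the ring kernel the overlap `|x ∧ v|` is even: summing the kernel equations
`[x_b v_b] ≡ [v_{b-1}] + [v_{b+1}]` over `b` gives `|x ∧ v| ≡ 2|v| ≡ 0 (mod 2)` — the ring
case of BGK Lemma 1 (`q(v) ∈ {0,2}` on `L_q`). [cite: BravyiGossetKonigScience2018, §3 Lemma 1] -/
theorem even_wtAnd_of_inKernel {x v : Fin n → Bool} (hv : InKernel x v) : Even (wtAnd x v) := by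
  -- `[x_b ∧ v_b] = [v (prv b)] + [v (nxt b)] (mod 2)` pointwise, as natural numbers modulo 2
  have hpt : ∀ b : Fin n, (if x b = true ∧ v b = true then 1 else 0 : ℕ) % 2 =
      ((if v (prv b) = true then 1 else 0 : ℕ) + (if v (nxt b) = true then 1 else 0)) % 2 := by
    intro b
    have hb := hv b
    revert hb
    cases x b <;> cases v b <;> cases v (prv b) <;> cases v (nxt b) <;> simp
  unfold wtAnd
  rw [card_filter, Nat.even_iff, Finset.sum_nat_mod, Finset.sum_congr rfl fun b _ => hpt b,
    ← Finset.sum_nat_mod, Finset.sum_add_distrib]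
  -- both sums equal `|v|` by reindexing along the bijections `prv`, `nxt`
  have h1 : (∑ b : Fin n, (if v (prv b) = true then 1 else 0 : ℕ)) =
      ∑ b : Fin n, (if v b = true then 1 else 0 : ℕ) :=
    Finset.sum_bij (fun b _ => prv b) (fun _ _ => mem_univ _) (fun a _ b _ h => prv_injective h)
      (fun b _ => ⟨nxt b, mem_univ _, prv_nxt b⟩) (fun _ _ => rfl)
  have h2 : (∑ b : Fin n, (if v (nxt b) = true then 1 else 0 : ℕ)) =
      ∑ b : Fin n, (if v b = true then 1 else 0 : ℕ) :=
    Finset.sum_bij (fun b _ => nxt b) (fun _ _ => mem_univ _) (fun a _ b _ h => nxt_injective h)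
      (fun b _ => ⟨prv b, mem_univ _, nxt_prv b⟩) (fun _ _ => rfl)
  rw [h1, h2, ← two_mul, Nat.mul_mod_right]

end RingHLF

namespace GridCycle

open RingHLF

variable {N n : ℕ} {γ : GridCycle N n}

/-- **The quadratic form of a cycle instance** (`n ≥ 3`): for EVERY grid vector `w`,
`q(w) = 2·#edges(supp w|_γ) + |x ∧ w|_γ| (mod 4)` — `A` and `b` live on the cycle
(BGK Eq. (1) evaluated on Eq. (31)-type instances; tree `HLFInstance.q_eq_symm`).
[cite: BravyiGossetKonigScience2018, §4.2 Eq. (31)] -/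
theorem q_ringInstance (hn : 3 ≤ n) (x : Fin n → Bool) (w : Fin N × Fin N → Bool) :
    (γ.ringInstance x).q w =
      2 * (edgesIn (fun i => w (γ.toFun i)) : ZMod 4) + (wtAnd x (fun i => w (γ.toFun i)) : ZMod 4) := by
  rw [HLFInstance.q_eq_symm _ (ringInstance_isValid x)]
  congr 1
  · -- quadratic part
    rw [γ.sum_eq_sum_toFun]
    · have hin : ∀ i, (∑ a', if (γ.ringInstance x).A (γ.toFun i) a' = true ∧
          w (γ.toFun i) = true ∧ w a' = true then (1 : ZMod 4) else 0) =
          (if w (γ.toFun i) = true ∧ w (γ.toFun (nxt i)) = true then (1 : ZMod 4) else 0) +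
            (if w (γ.toFun i) = true ∧ w (γ.toFun (prv i)) = true then (1 : ZMod 4) else 0) := by
        intro i
        rw [γ.sum_eq_sum_toFun]
        · simp only [ringInstance_A_apply]
          rw [← Finset.sum_erase_add _ _ (mem_univ (nxt i)),
            ← Finset.sum_erase_add _ _ (Finset.mem_erase.2 ⟨prv_ne_nxt hn i, mem_univ (prv i)⟩)]
          rw [Finset.sum_eq_zero, zero_add]
          · have h2 : (prv i = nxt i ∨ i = nxt (prv i)) := Or.inr (by rw [nxt_prv])
            simp only [true_or, true_and, h2]
            rw [add_comm]
          · intro j hj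
            rw [Finset.mem_erase, Finset.mem_erase] at hj
            rw [if_neg]
            rintro ⟨h, -⟩
            rcases h with h' | h'
            · exact hj.2.1 h'
            · exact hj.1 (by rw [h', prv_nxt])
        · intro a ha
          rw [if_neg]
          rintro ⟨h, -, -⟩
          obtain ⟨-, ⟨j, hj⟩⟩ := ringInstance_A_eq_true h
          exact ha j hj
      simp_rw [hin]
      rw [Finset.sum_add_distrib, two_mul]
      congr 1
      · unfold edgesIn
        rw [natCast_card_filter]
      · unfold edgesIn
        rw [natCast_card_filter]
        rw [show (∑ i : Fin n, if w (γ.toFun i) = true ∧ w (γ.toFun (prv i)) = true then (1 : ZMod 4) else 0) =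
            ∑ i : Fin n, (if w (γ.toFun (nxt (prv i))) = true ∧ w (γ.toFun (prv i)) = true
              then (1 : ZMod 4) else 0) by simp only [nxt_prv]]
        rw [show (∑ i : Fin n, if w (γ.toFun (nxt (prv i))) = true ∧ w (γ.toFun (prv i)) = true
              then (1 : ZMod 4) else 0) =
            ∑ j : Fin n, (if w (γ.toFun (nxt j)) = true ∧ w (γ.toFun j) = true then (1 : ZMod 4) else 0) from
          Finset.sum_bij (fun i _ => prv i) (fun _ _ => mem_univ _)
            (fun a _ b _ h => prv_injective h) (fun j _ => ⟨nxt j, mem_univ _, prv_nxt j⟩)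
            (fun _ _ => rfl)]
        refine Finset.sum_congr rfl fun j _ => ?_
        simp only [and_comm]
    · intro a ha
      apply Finset.sum_eq_zero
      intro a' _
      rw [if_neg]
      rintro ⟨h, -, -⟩
      obtain ⟨⟨j, hj⟩, -⟩ := ringInstance_A_eq_true h
      exact ha j hj
  · -- linear part
    rw [γ.sum_eq_sum_toFun]
    · unfold wtAnd
      rw [natCast_card_filter]
      simp only [ringInstance_b_apply]
    · intro a ha
      rw [if_neg]
      rintro ⟨h, -⟩
      obtain ⟨j, hj⟩ := ringInstance_b_eq_true h
      exact ha j hj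

/-- HLF solutions of a cycle instance vanish off the cycle (`n ≥ 3`): the unit vector `e_a` of a
vertex `a ∉ γ` lies in `L_q` with `q(e_a) = 0`, so `2 z_a = q(e_a) = 0`.
[cite: BravyiGossetKonigScience2018, §4.2 Eq. (31)] -/
theorem eq_false_of_mem_hlfSolutions (hn : 3 ≤ n) (x : Fin n → Bool) {z : Fin N × Fin N → Bool}
    (hz : z ∈ hlfSolutions (γ.ringInstance x)) (a : Fin N × Fin N) (ha : ∀ i, γ.toFun i ≠ a) :
    z a = false := by
  classical
  -- the unit vector at `a`
  set e : Fin N × Fin N → Bool := fun a' => decide (a' = a) with he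
  have he0 : ∀ i, e (γ.toFun i) = false := fun i => by
    rw [he]; exact decide_eq_false (ha i)
  have heLq : e ∈ (γ.ringInstance x).Lq := by
    rw [mem_Lq_iff hn]
    intro b
    simp only [he0, Bool.and_false, Bool.xor_false]
  have hq := hz e heLq
  rw [q_ringInstance hn] at hq
  have hE : edgesIn (fun i => e (γ.toFun i)) = 0 := by
    unfold edgesIn; rw [Finset.card_eq_zero, Finset.filter_eq_empty_iff]
    intro b _; simp [he0]
  have hW : wtAnd x (fun i => e (γ.toFun i)) = 0 := by
    unfold wtAnd; rw [Finset.card_eq_zero, Finset.filter_eq_empty_iff]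
    intro b _; simp [he0]
  rw [hE, hW, Nat.cast_zero, mul_zero, zero_add] at hq
  -- the right-hand side counts `{a' | z a' ∧ a' = a}`
  have hcount : (univ.filter fun v => z v = true ∧ e v = true) =
      if z a = true then {a} else ∅ := by
    ext v
    simp only [mem_filter, mem_univ, true_and, he, decide_eq_true_eq]
    split_ifs with hza
    · simp only [mem_singleton]
      constructor
      · rintro ⟨-, rfl⟩; rfl
      · rintro rfl; exact ⟨hza, rfl⟩
    · simp only [Finset.notMem_empty, iff_false, not_and]
      rintro hzv rfl; exact hza hzv
  by_contra hza
  rw [Bool.not_eq_false] at hza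
  have : (∑ v, if z v = true ∧ e v = true then (1 : ZMod 4) else 0) = 1 := by
    rw [← natCast_card_filter, hcount, if_pos hza, card_singleton, Nat.cast_one]
  rw [this] at hq
  exact absurd hq (by decide)

/-- **Converse transfer** (`n ≥ 3`): a grid vector vanishing off the cycle whose restriction to
the cycle solves the ring relation is a 2D-HLF solution of the cycle instance; so
`hlfSolutions (ringInstance γ x)` is EXACTLY the set of zero-padded ring solutions
(`mem_hlfSolutions_iff`). [cite: BravyiGossetKonigScience2018, §4.1] -/
theorem mem_hlfSolutions_of_rel (hn : 3 ≤ n) (x : Fin n → Bool) {z : Fin N × Fin N → Bool}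
    (hz0 : ∀ a, (∀ i, γ.toFun i ≠ a) → z a = false) (hrel : Rel x (fun i => z (γ.toFun i))) :
    z ∈ hlfSolutions (γ.ringInstance x) := by
  intro w hw
  set v : Fin n → Bool := fun i => w (γ.toFun i) with hv
  have hvK : InKernel x v := (mem_Lq_iff hn x w).1 hw
  have hdot := hrel v hvK
  obtain ⟨c2, hc2⟩ := even_wtAnd_of_inKernel hvK
  rw [q_ringInstance hn]
  -- the solution count lives on the cycle
  have hsol : ((univ.filter fun a => z a = true ∧ w a = true).card : ZMod 4) =
      ((univ.filter fun b : Fin n => v b = true ∧ z (γ.toFun b) = true).card : ZMod 4) := by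
    rw [natCast_card_filter, natCast_card_filter, γ.sum_eq_sum_toFun]
    · simp only [hv, and_comm]
    · intro a ha
      rw [if_neg]
      rintro ⟨h, -⟩
      rw [hz0 a ha] at h
      exact Bool.false_ne_true h
  rw [← natCast_card_filter, hsol]
  -- arithmetic modulo 4 from the bit identity `dot2 = signBit`
  unfold dot2 signBit at hdot
  set c := (univ.filter fun b : Fin n => v b = true ∧ z (γ.toFun b) = true).card
  set e := edgesIn v
  change (2 * (e : ZMod 4) + (wtAnd x v : ZMod 4)) = 2 * (c : ZMod 4)
  rw [hc2] at hdot ⊢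
  rw [show c2 + c2 = 2 * c2 by ring, Nat.mul_div_cancel_left _ (by norm_num : 0 < 2)] at hdot
  have h4 : (2 * e + 2 * c2) % 4 = (2 * c) % 4 := by omega
  have := (ZMod.natCast_eq_natCast_iff' (2 * e + 2 * c2) (2 * c) 4).2 h4
  push_cast at this ⊢
  linear_combination this

/-- **`hlfSolutions` of a cycle instance = zero-padded ring solutions** (`n ≥ 3`).
[cite: BravyiGossetKonigScience2018, §4.1] -/
theorem mem_hlfSolutions_iff (hn : 3 ≤ n) (x : Fin n → Bool) (z : Fin N × Fin N → Bool) :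
    z ∈ hlfSolutions (γ.ringInstance x) ↔
      (∀ a, (∀ i, γ.toFun i ≠ a) → z a = false) ∧ Rel x (fun i => z (γ.toFun i)) :=
  ⟨fun hz => ⟨eq_false_of_mem_hlfSolutions hn x hz, rel_of_mem_hlfSolutions hn x hz⟩,
    fun h => mem_hlfSolutions_of_rel hn x h.1 h.2⟩

/-- Hence the ring relation is always solvable: pad any 2D-HLF solution (tree
`hlfSolutions_nonempty_holds`, BGK Lemma 1). [cite: BravyiGossetKonigScience2018, §3 Lemma 1] -/
theorem rel_nonempty (γ : GridCycle N n) (hn : 3 ≤ n) (x : Fin n → Bool) : ∃ z, Rel x z := by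
  obtain ⟨z, hz⟩ := hlfSolutions_nonempty_holds (γ.ringInstance x)
  exact ⟨fun i => z (γ.toFun i), rel_of_mem_hlfSolutions hn x hz⟩

end GridCycle

/-! ### Quantum half: the ring relation is solved with certainty by BGK's circuit -/

section Quantum

open Cryptography BGK RingHLF

/-- **The ring relation is in advice-free `QNC⁰` (certainty).** For `t ≥ 2`, `N > 2t` and every
pattern `x ∈ {0,1}^{8t}`: measuring all wires of `hlfCircuit N` run on
`|encodeHLF (ringInstance (GridCycle.square t) x)⟩|0^{N²}⟩` yields with probability `1` an
outcome `y` with `RingHLF.Rel x (i ↦ y (hlfOut (γ i)))`, `γ = GridCycle.square t`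
(BGK 2018 Thm. 1 on cycle instances). [cite: BravyiGossetKonigScience2018, Theorem 1] -/
theorem ring_rel_quantum_certain {N : ℕ} (t : ℕ) (ht : 2 ≤ t) (hN : 2 * t < N)
    (x : Fin (8 * t) → Bool) :
    ((hlfCircuit N).outputPMF 0 (encodeHLF ((GridCycle.square t ht hN).ringInstance x))).toOuterMeasure
        {y | Rel x fun i => y (hlfOut ((GridCycle.square t ht hN).toFun i))} = 1 := by
  set γ := GridCycle.square t ht hN
  obtain ⟨-, -, -, hsol⟩ := hlf_quantum_circuit_explicit N
  have h1 := hsol (γ.ringInstance x) (GridCycle.ringInstance_isValid x)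
  rw [PMF.toOuterMeasure_apply_eq_one_iff] at h1 ⊢
  intro y hy
  have hy' := h1 hy
  simp only [Set.mem_setOf_eq] at hy' ⊢
  exact GridCycle.rel_of_mem_hlfSolutions (by omega) x hy'

end Quantum

end Literature.Computability.QuantumComplexity
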